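import Summits.QuantumFields.YangMills.Theorems.BalabanUVNodesN22W1RelCentredSliceInputsLG
import Literature.MathematicalPhysics.QuantumFieldTheory.Balaban1983to89.B13TermWalkDataOneTorus

/-!
# BalabanUVNodes ∕ node N22 = NE9 — THE RELATIVE-DISC CENTRED ROAD, MODULE J10-Wb: THE LOCATED-INPUT RECORD `SliceInputsLG` IS INHABITED AT A LABEL WITHOUT large-field boxes (`P(t) = ∅`)
# — second half of the A6 witness director-ym №193 ∕ standing rule №189 asks of the re-knit J10c (first half, `1 ≤ |P(t)|`: module J10-W)

Cell `pub-ymgap`, HUMAN RULING D-0062 (Track A), R134 ACCELERATION re-seat `pub-ymgap-dag-n22-c` (strategy s1), generation 8, file J10-Wb.  THEOREMS ONLY; imports J10-D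
`…N22W1RelCentredSliceInputsLG` (the record) and `B13TermWalkDataOneTorus` (NODE A's `freeKernels`) — SELF-CONTAINED (it does not import its sibling J10-W
`…SliceInputsLGWitness`, whose elementary rate fact `exp_neg_posLog_le` is re-proved here as a private lemma, so that the two halves build independently).  `--supports` K3⁷
`SpineGivenEndpointR13SepCoPH` (stmt-QuantumFields-20544) as a helper.

WHY.  ref-G g15's SECOND-GAP flag on J9 (p539663; director-ym №193, bus 2026-08-27 17:06Z): J9-D's record was CONTRADICTORY at labels with `P(t) ≠ ∅` (box law at `B′ = 0` + (2.22) +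
the box-tail ∕ large-field rates against the knit's smallness), so the J9 knit was VACUOUS-ι.  J10-D split the record (box block only on `P(t) = ∅`, (2.22)-surplus block only on
`P(t) ≠ ∅`).  THIS FILE is the A6 witness the ruling asks for: the record TYPE `SliceInputsLG 𝔇 χᵘ χᶜᵘ 𝒲 𝒪 c Sg Rz cs E₀ κ_E Z t φ s₀ a a₅ ρb Mv` is INHABITED — (module J10-W) at every label
`t` with `1 ≤ |P(t)|`, (§2, THIS FILE) at every label with `P(t) = ∅` — for EVERY nonempty domain `Z`, configuration `φ`, tables `(Sg, Rz, cs)`, size letters `(E₀, κ_E)`, weight letter `a`, base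
point `s₀ > 0` and vertex constant `Mv > 1` (the knit's regime `Mv·((1+c_A)γ)² ≤ ½(1−c_P)²` has `Mv` LARGE, so `Mv > 1` is the relevant side), at the ball radius `ρb = 1∕12` and the
weight exponent `a₅ = 2`, for every constants record `c` with the elementary sign ∕ size conditions that make W1-8's located τ-letters `0 < invTau c d ≤ ½` hold.  The inhabitant is
DEGENERATE (nothing of print's): W1-7's honesty datum — NODE A's free kernels on ONE row bond (`A ≡ 1`, `G ≡ 0`, `Γ₀ = 0`, `C = 1`, zero-dimensional site torus), Cauchy radius `1`,
zero potentials `𝒲 = 𝒪 = 0` (so every older-term letter holds for EVERY history, admissible or not), boxes `χᵘ = χᶜᵘ ≡ 0` at the large-field label (print: a large-field term's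
characteristic functions vanish near `B′ = 0`) resp. `≡ 1` with empty box support `S₀ = ∅` at the small-field label; regions `Uσ = ℂ`, `Uτ(Y) = ball 0 (invTau⁻¹ + 3)`; letters
`κ := γ₂ := 1∕20`, `θ := 1∕5`, `kap = 3 > kap′ = 2 > kap″ = 1`, `K_{Cσ} = K₀ = K_E = c_E = 1`, all growth constants `0`; the two RATES are met by choosing the box radius `Rb` resp. the
(2.22) radius `r_P` from `log⁺(1∕((Mv−1)s₀²))` resp. `log⁺(1∕(Mv s₀²))` — exactly the quantities that were contradictory before the split, now consistent in their own regimes.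

THE DATUM BY NAME.  The inlined datum is VERBATIM node00-def-W1 W1-15's `W1.TermDatum214.free c P 𝔸 M k L` (`Node00/HistoryTermDatum214Free`, p555497 — landed while this file was
being typed; its farm build was not yet available at filing time): re-pointing the `obtain ⟨𝔇, h𝔇⟩` line to `𝔇 = TermDatum214.free c P 𝔸 M k L` is a one-line follow-up (twin kept on
the cell's HOME desk as `WitnessByName.lean`).

HONEST FRAMING.  An INHABITATION witness of a HYPOTHESIS RECORD at degenerate data (A6 ∕ №189: «the binder is not contradictory, in both regimes, at the knit's side of `Mv`»); it
asserts NOTHING of Bałaban's and does NOT inhabit the record at the datum OF RECORD (NODE A's ∕ N09's ∕ N10's ∕ def-W1's business); count-neutral; N22 NOT discharged; one finite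
four-torus programme at fixed ε — NOT infinite volume, NOT OS on ℝ⁴, NOT a mass gap, NOT Clay.  0 `sorry`, 0 `def`, standard axioms.

References (TYPES only): [II] = [Balaban1988RG2Cluster] (2.3) p. 12, (2.14) p. 15, (2.22) p. 16; [I] = [Balaban1987RG1] (2.9)–(2.13) pp. 266–268.
-/

noncomputable section

namespace YMDAG.N22.W1

open Set Metric Matrix
open scoped BigOperators
open Literature.MathematicalPhysics.QuantumFieldTheory.Balaban1983to89
open Literature.MathematicalPhysics.QuantumFieldTheory.Balaban1983to89.TreeLengthTorus (TPt TDom tsys torusTreeLen torusTreeLen_nonneg)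
open Literature.MathematicalPhysics.QuantumFieldTheory.Balaban1983to89.B13Bound143 (invTau invTau_pos)
open Literature.MathematicalPhysics.QuantumFieldTheory.Balaban1983to89.B9Thm37GlueTorus (tdist1 tdist1_self)
open Literature.MathematicalPhysics.QuantumFieldTheory.Balaban1983to89.B5TorusCover (UT)
open Literature.MathematicalPhysics.QuantumFieldTheory.Balaban1983to89.B13TermWalkDataOneTorus (freeKernels)
open Literature.MathematicalPhysics.QuantumFieldTheory.Balaban1983to89.B13Term214 (term214 core214 F214)
open Literature.MathematicalPhysics.QuantumFieldTheory.Balaban1983to89.Step (SFConsts)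
open Literature.MathematicalPhysics.QuantumFieldTheory.Balaban1983to89.Node00.Sect2 (domSys domCount CPair spaceI domSites Setting Residual)
open Literature.MathematicalPhysics.QuantumFieldTheory.Balaban1983to89.Node00.W1

variable (c : B13.Consts) (P : Params) (𝔸 : Type*) [NormedRing 𝔸] [NormedAlgebra ℂ 𝔸] [CompleteSpace 𝔸] (M k L : ℕ) [NeZero L]

/-- `exp (−max 0 (−log ε)) ≤ ε` for `ε > 0` (private copy of J10-W's `exp_neg_posLog_le`). [folklore] (elementary) -/
private theorem exp_neg_posLog_le' {ε : ℝ} (hε : 0 < ε) : Real.exp (-(max 0 (-Real.log ε))) ≤ ε := by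
  rcases le_or_gt 1 ε with h | h
  · have : max 0 (-Real.log ε) = 0 := max_eq_left (neg_nonpos.2 (Real.log_nonneg h))
    rw [this, neg_zero, Real.exp_zero]
    exact h
  · have : max 0 (-Real.log ε) = -Real.log ε := max_eq_right (neg_nonneg.2 (Real.log_nonpos hε.le h.le))
    rw [this, neg_neg, Real.exp_log hε]

/-! ## §2 The record is inhabited at a label WITHOUT large-field boxes (`P(t) = ∅`) -/

open Classical in
/-- **★ `SliceInputsLG` IS INHABITED AT EVERY LABEL WITH `P(t) = ∅`** (the small-field regime: the BOX block is live, the (2.22)-surplus block idle) — same universality as §1: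
witnessed by W1-7's degenerate datum, zero potentials, boxes `χᵘ = χᶜᵘ ≡ 1` with EMPTY box support `S₀ = ∅` (so the s-free support law and the box law `χχᶜ = 1` both hold), the
box-tail rate met by the box radius `Rb² = 40·log⁺(1∕((Mv − 1)s₀²))` with `T := Mv − 1` (so `1 + T ≤ Mv`).  A6 witness; nothing of print's.
[cite: Balaban1987RG1, (2.9)-(2.13) pp.266-268; Balaban1988RG2Cluster, (2.3) p.12 (degenerate data; bookkeeping)] -/
theorem sliceInputsLG_inhabited_smallField (hκ₁ : 1 ≤ c.κ₁) (hE : 0 < c.E₀) (hε : 0 < c.ε₁) (hC₁ : 0 < c.C₁) (hα : 0 < c.α₄) (hMc : 0 < c.M)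
    (hδκ : 0 ≤ (1 - 3 * c.δ) * c.κ) (hpref : c.E₀ * c.ε₁ * c.C₁ * c.α₄⁻¹ * c.M ^ c.q * Real.exp (c.C₂ * c.κ₁) ≤ 1 / 2)
    {G : Type*} [GaugeGroup G] (Sg : Setting 𝔸 G) (Rz : Residual P 𝔸) (cs : SFConsts) (E₀ κE : ℝ)
    (Z : (domSys P M (k + 1)).Dom) (hZ : 1 ≤ (Z.1).card) (t : TermLabel P M k L) (hP : t.2 = ∅) (φ : CPair P 𝔸)
    {s₀ Mv : ℝ} (hs₀ : 0 < s₀) (hMv : 1 < Mv) (a : ℝ) :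
    ∃ (𝔇 : TermDatum214 c P 𝔸 M k L)
      (χu χcu : (Z : (domSys P M (k + 1)).Dom) → (t : TermLabel P M k L) → ((𝔇.𝒦 Z t).Λ → ℝ) → ℝ)
      (𝒲 : (Z : (domSys P M (k + 1)).Dom) → (t : TermLabel P M k L) → CPair P 𝔸 → TDom P.d (L * domCount P M (k + 1)) → ((𝔇.𝒦 Z t).Λ → ℝ) → ℂ)
      (𝒪 : (Z : (domSys P M (k + 1)).Dom) → (t : TermLabel P M k L) → OlderTerms P 𝔸 M k → CPair P 𝔸 → TDom P.d (L * domCount P M (k + 1)) →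
        ((𝔇.𝒦 Z t).Λ → ℝ) → ℂ),
      Nonempty (SliceInputsLG 𝔇 χu χcu 𝒲 𝒪 c Sg Rz cs E₀ κE Z t φ s₀ a 2 (1 / 12) Mv) := by
  haveI hNe : ∀ i : Fin 0, NeZero ((![] : Fin 0 → ℕ) i) := fun i => i.elim0
  let z : UT (![] : Fin 0 → ℕ) := UT.ofSite (N := (![] : Fin 0 → ℕ)) fun i => i.elim0
  -- W1-7's degenerate datum, kept OPAQUE (an equation `h𝔇`) so that the record's baked instances are found syntactically
  obtain ⟨𝔇, h𝔇⟩ : ∃ 𝔇 : TermDatum214 c P 𝔸 M k L, 𝔇 =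
      { ν := 0, Nf := ![], E₃ := ℂ,
        𝒦 := fun _ _ => freeKernels c ℂ Unit Empty (fun _ => z) (fun _ => z),
        finC₀ := fun _ _ => inferInstanceAs (Fintype Empty),
        decC₀ := fun _ _ => inferInstanceAs (DecidableEq Empty),
        uOf := fun _ _ _ => 0, r := 1,
        chiY₀ := fun _ _ _ _ => 0, chicP := fun _ _ _ _ => 0,
        𝒱 := fun _ _ _ _ _ _ _ => 0 } := ⟨_, rfl⟩
  have hP0 : t.2.card = 0 := by rw [hP, Finset.card_empty]
  -- the datum's reductions (by `subst`, each in its own `have`)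
  have hA1 : ∀ (ψ : CPair P 𝔸) (σ : TPt P.d (domCount P M (k + 1)) → ℂ), 𝔇.A Z t ψ σ = 1 := by intro ψ σ; subst h𝔇; rfl
  have hG0 : ∀ (σ : TPt P.d (domCount P M (k + 1)) → ℂ) (ψ : CPair P 𝔸), (𝔇.𝒦 Z t).G2 σ (𝔇.uOf Z t ψ) = 0 := by intro σ ψ; subst h𝔇; rfl
  have hΓ0 : (𝔇.𝒦 Z t).Γ₀ = 0 := by subst h𝔇; rfl
  have hC1 : (𝔇.𝒦 Z t).C = 1 := by subst h𝔇; rfl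
  have hm : (𝔇.𝒦 Z t).m = 1 := by subst h𝔇; rfl
  have hpow : ∀ x : ℝ, x ^ 𝔇.ν = 1 := fun x => by subst h𝔇; exact pow_zero x
  have hr1 : 𝔇.r = 1 := by subst h𝔇; rfl
  have hGam : ∀ (ψ : CPair P 𝔸) (σ : TPt P.d (domCount P M (k + 1)) → ℂ) (X : (𝔇.𝒦 Z t).Λ ⊕ (𝔇.𝒦 Z t).C₀ → ℝ), 𝔇.Gam Z t ψ σ X = 0 := by
    intro ψ σ X; rw [TermDatum214.Gam, hG0, Matrix.zero_mulVec]
  have hcardΛ : Fintype.card (𝔇.𝒦 Z t).Λ = 1 := by subst h𝔇; exact Fintype.card_unit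
  have hcardΛC : Fintype.card ((𝔇.𝒦 Z t).Λ ⊕ (𝔇.𝒦 Z t).C₀) = 1 := by
    have h0 : Fintype.card (𝔇.𝒦 Z t).C₀ = 0 := Fintype.card_eq_zero_iff.2 ⟨fun x => by subst h𝔇; exact Empty.elim x⟩
    rw [Fintype.card_sum, hcardΛ, h0]
  -- W1-8's located τ-letters from the elementary conditions on `c`
  have hposY : ∀ Y : TDom P.d (L * domCount P M (k + 1)), 0 < invTau c ((tsys P.d (L * domCount P M (k + 1))).dj Y) := fun Y =>
    invTau_pos c hE hε hC₁ hα hMc _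
  have hhalfY : ∀ Y : TDom P.d (L * domCount P M (k + 1)), invTau c ((tsys P.d (L * domCount P M (k + 1))).dj Y) ≤ 1 / 2 := by
    intro Y
    have hd : 0 ≤ (tsys P.d (L * domCount P M (k + 1))).dj Y := torusTreeLen_nonneg Y.1
    have hpref0 : 0 ≤ c.E₀ * c.ε₁ * c.C₁ * c.α₄⁻¹ * c.M ^ c.q * Real.exp (c.C₂ * c.κ₁) := by positivity
    unfold invTau
    calc c.E₀ * c.ε₁ * c.C₁ * c.α₄⁻¹ * c.M ^ c.q * Real.exp (c.C₂ * c.κ₁) * Real.exp (-(1 - 3 * c.δ) * c.κ * (tsys P.d (L * domCount P M (k + 1))).dj Y)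
        ≤ c.E₀ * c.ε₁ * c.C₁ * c.α₄⁻¹ * c.M ^ c.q * Real.exp (c.C₂ * c.κ₁) * 1 := by
          refine mul_le_mul_of_nonneg_left (Real.exp_le_one_iff.2 ?_) hpref0
          have : 0 ≤ (1 - 3 * c.δ) * c.κ * (tsys P.d (L * domCount P M (k + 1))).dj Y := mul_nonneg hδκ hd
          linarith
      _ ≤ 1 / 2 := by rw [mul_one]; exact hpref
  -- the box radius from the box-tail rate
  set y : ℝ := max 0 (-Real.log ((Mv - 1) * s₀ ^ 2)) with hy
  have hy0 : 0 ≤ y := le_max_left _ _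
  have hMv1 : 0 < Mv - 1 := sub_pos.2 hMv
  have hrate : Real.exp (-y) ≤ (Mv - 1) * s₀ ^ 2 := exp_neg_posLog_le' (by positivity)
  set rP : ℝ := Real.sqrt (20 * max a 0) with hrPdef
  set Rb : ℝ := Real.sqrt (40 * y) with hRbdef
  have hrPsq : rP ^ 2 = 20 * max a 0 := Real.sq_sqrt (by positivity)
  have hRbsq : Rb ^ 2 = 40 * y := Real.sq_sqrt (by positivity)
  have hA1' : ∀ ψ : CPair P 𝔸, 𝔇.A Z t ψ = fun _ => 1 := fun ψ => funext (hA1 ψ)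
  have hGam' : ∀ ψ : CPair P 𝔸, 𝔇.Gam Z t ψ = fun _ _ => 0 := fun ψ => funext fun σ => funext (hGam ψ σ)
  refine ⟨𝔇, fun _ _ _ => 1, fun _ _ _ => 1, fun _ _ _ _ _ => 0, fun _ _ _ _ _ _ => 0, ⟨?_⟩⟩
  exact
    { Uσ := univ
      Uτ := fun Y => ball 0 ((invTau c ((tsys P.d (L * domCount P M (k + 1))).dj Y))⁻¹ + 3)
      γ₂ := 1 / 20, rP := rP, qP := fun B => B ⬝ᵥ B, kap := 3, kap' := 2, kap'' := 1, θ := 1 / 5,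
      θE := 0, θΓ := 0, θC := 0, KG := 0, KΓ := 0, KCs := 1, K₀ := 1, KE := 1, KG' := 0, KCs' := ((1 - 1 / 12) ^ 2)⁻¹, θΓ' := 0,
      θC' := 1 / 12 * (2 + 1 / 12) * ((1 - 1 / 12) ^ 2)⁻¹ * 1, θE' := 1 / 12 * (2 + 1 / 12), a' := 0, w' := 0, cE := 1, g := 0,
      Rb := Rb, κ := 1 / 20, a₀ := 0, w₀ := 0, T := Mv - 1, α₀ := 0, r₁ := 0, TP := 0, ac := 1 / 20, wc := 0,
      hpos := hposY, hhalf := hhalfY,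
      hUσ := isOpen_univ, hUτ := fun _ => isOpen_ball, hUexp := subset_univ _,
      hUtau := fun Y => closedBall_subset_ball (by linarith),
      hr := by rw [hr1]; exact zero_lt_one,
      hr' := by rw [hr1]; linarith [Real.add_one_le_exp c.κ₁],
      hsubτ := by
        intro Y x hx w hw
        rw [Set.uIcc_of_le zero_le_one] at hx
        rw [mem_closedBall, hr1] at hw
        rw [mem_ball, dist_zero_right]
        have hx1 : ‖(x : ℂ)‖ ≤ 1 := by rw [Complex.norm_real, Real.norm_eq_abs]; exact abs_le.2 ⟨by linarith [hx.1], hx.2⟩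
        have hinv : 0 < (invTau c ((tsys P.d (L * domCount P M (k + 1))).dj Y))⁻¹ := inv_pos.2 (hposY Y)
        calc ‖w‖ = ‖(w - (x : ℂ)) + (x : ℂ)‖ := by rw [sub_add_cancel]
          _ ≤ ‖w - (x : ℂ)‖ + ‖(x : ℂ)‖ := norm_add_le _ _
          _ ≤ 1 + 1 := add_le_add (by rw [← dist_eq_norm]; exact hw) hx1
          _ < (invTau c ((tsys P.d (L * domCount P M (k + 1))).dj Y))⁻¹ + 3 := by linarith,
      hχ0 := fun _ => zero_le_one, hχc0 := fun _ => zero_le_one, hχm := measurable_const, hχcm := measurable_const,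
      h222 := fun B => by
        rw [hP0, Nat.cast_zero, mul_zero, neg_zero, zero_add, one_mul]
        refine Real.one_le_exp (mul_nonneg (by norm_num) ?_)
        show (0 : ℝ) ≤ ∑ i, B i * B i
        exact Finset.sum_nonneg fun i _ => mul_self_nonneg (B i),
      hγ₂ := by norm_num, hqP := fun _ => le_rfl,
      hAhol := fun i j => by simp only [hA1]; exact differentiableOn_const _,
      hGhol := fun i j => by simp only [hG0]; exact differentiableOn_const _,
      hAs := fun σ _ => by rw [hA1]; exact Matrix.isSymm_one,
      hfibN := fun x => (Finset.card_filter_le _ _).trans (by rw [Finset.card_univ, hcardΛC, hm]),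
      hkap'' := by norm_num, hk1 := by norm_num, hk2 := by norm_num,
      hθE := le_rfl, hθΓ := le_rfl, hθC := le_rfl, hKG := le_rfl, hKΓ := le_rfl, hKCs := zero_le_one, hK₀ := zero_le_one, hKE := zero_le_one,
      hG := fun σ _ b j => by rw [hG0, Matrix.zero_apply, norm_zero, zero_mul],
      hΓ₀ := fun b j => by rw [hΓ0, Matrix.zero_apply, norm_zero, zero_mul],
      hCs := fun σ _ b b' => by
        rw [hA1, inv_one]
        by_cases hb : b = b'
        · subst hb; rw [Matrix.one_apply_eq, norm_one, tdist1_self, mul_zero, neg_zero, Real.exp_zero, mul_one]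
        · rw [Matrix.one_apply_ne hb, norm_zero]; positivity,
      hC216 := fun b b' => by
        rw [hC1]
        by_cases hb : b = b'
        · subst hb; rw [Matrix.one_apply_eq, norm_one, tdist1_self, mul_zero, neg_zero, Real.exp_zero, mul_one]
        · rw [Matrix.one_apply_ne hb, norm_zero]; positivity,
      hCE := fun b b' => by
        rw [hC1, inv_one, Matrix.map_one _ (map_zero _) (map_one _)]
        by_cases hb : b = b'
        · subst hb; rw [Matrix.one_apply_eq, norm_one, tdist1_self, mul_zero, neg_zero, Real.exp_zero, mul_one]
        · rw [Matrix.one_apply_ne hb, norm_zero]; positivity,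
      hdΓ := fun σ _ b j => by rw [hG0, hΓ0, Matrix.map_zero _ (map_zero _), sub_zero, Matrix.zero_apply, norm_zero, zero_mul],
      hdC := fun σ _ b b' => by rw [hA1, hC1, inv_one, Matrix.map_one _ (map_zero _) (map_one _), sub_self, Matrix.zero_apply, norm_zero, zero_mul],
      hdE := fun σ _ b b' => by rw [hA1, hC1, inv_one, Matrix.map_one _ (map_zero _) (map_one _), sub_self, Matrix.zero_apply, norm_zero, zero_mul],
      hKG' := by norm_num, hKCs' := by norm_num, hθΓ' := by norm_num, hθC' := by norm_num, hθE' := by norm_num,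
      hθEle := by norm_num, hθΓle := by norm_num,
      hθR1le := by simp only [hpow, hm, Nat.cast_one, mul_one]; norm_num,
      hsmallKθ := by simp only [hpow, hm, Nat.cast_one, mul_one]; norm_num,
      hc0 := zero_le_one,
      hc := fun i => by
        haveI : Nonempty (𝔇.𝒦 Z t).Λ := ⟨i⟩
        have h : (𝔇.𝒦 Z t).hC.1.eigenvalues i ∈ spectrum ℝ (1 : Matrix (𝔇.𝒦 Z t).Λ (𝔇.𝒦 Z t).Λ ℝ) := by
          have h0 := (𝔇.𝒦 Z t).hC.1.eigenvalues_mem_spectrum_real i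
          rwa [show spectrum ℝ (𝔇.𝒦 Z t).C = spectrum ℝ (1 : Matrix (𝔇.𝒦 Z t).Λ (𝔇.𝒦 Z t).Λ ℝ) by rw [hC1]] at h0
        rw [spectrum.one_eq, Set.mem_singleton_iff] at h
        exact h.le,
      hαc := by simp only [hpow, hm, Nat.cast_one, mul_one]; norm_num,
      hg := le_rfl,
      hΓq := fun X => by rw [hΓ0, Matrix.zero_mulVec, zero_dotProduct, zero_mul],
      hsmall := by simp only [hpow, hm, Nat.cast_one, mul_one]; norm_num,
      hPa := by rw [hrPsq]; nlinarith [le_max_left a 0, le_max_right a 0],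
      hvol := by
        have h1 : (1 : ℝ) ≤ ((Z.1).card : ℝ) := Nat.one_le_cast.mpr hZ
        simp only [hpow, hm, hcardΛ, hcardΛC, Nat.cast_one, mul_one, one_mul]
        nlinarith [h1],
      hχe := fun _ => rfl, hχce := fun _ => rfl,
      hαc_c := by simp only [hpow, hm, Nat.cast_one, mul_one]; norm_num,
      hsmall_c := by simp only [hpow, hm, Nat.cast_one, mul_one]; norm_num,
      hvol_c := by
        have h1 : (1 : ℝ) ≤ ((Z.1).card : ℝ) := Nat.one_le_cast.mpr hZ
        simp only [hpow, hm, hcardΛ, hcardΛC, Nat.cast_one, mul_one, one_mul]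
        nlinarith [h1],
      hχ1 := fun _ _ => by rw [one_mul],
      hκ := by norm_num,
      hboxR := fun _ _ _ => one_mul 1,
      ha₀ := le_rfl,
      hαc_b := by simp only [hpow, hm, Nat.cast_one, mul_one]; norm_num,
      hsmall_b := by simp only [hpow, hm, Nat.cast_one, mul_one]; norm_num,
      hvol_b := by
        have h1 : (1 : ℝ) ≤ ((Z.1).card : ℝ) := Nat.one_le_cast.mpr hZ
        simp only [hpow, hm, hcardΛ, hcardΛC, Nat.cast_one, mul_one, one_mul]
        nlinarith [h1],
      hα₀ := le_rfl,
      hαc_f := by simp only [hpow, hm, Nat.cast_one, mul_one]; norm_num,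
      hsmall_f := by simp only [hpow, hm, Nat.cast_one, mul_one]; norm_num,
      hr₁ := fun h => absurd hP h,
      hPa1 := fun h => absurd hP h,
      hA := fun σ _ => by rw [hA1, Matrix.map_one _ Complex.zero_re Complex.one_re]; exact Matrix.PosDef.one,
      hθEle0 := by norm_num, hθΓle0 := by norm_num,
      hθR1le0 := by simp only [hpow, hm, Nat.cast_one, mul_one]; norm_num,
      hαc_0 := by simp only [hpow, hm, Nat.cast_one, mul_one]; norm_num,
      hsmall_0 := by simp only [hpow, hm, Nat.cast_one, mul_one]; norm_num,
      hvol_0 := by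
        have h1 : (1 : ℝ) ≤ ((Z.1).card : ℝ) := Nat.one_le_cast.mpr hZ
        simp only [hpow, hm, hcardΛ, hcardΛC, Nat.cast_one, mul_one, one_mul]
        nlinarith [h1],
      hRb := fun _ => by
        rw [hRbsq]
        have : -(1 / 20 / 2 * (40 * y)) = -y := by ring
        rw [this]
        exact hrate,
      hTP := fun h => absurd hP h,
      hMvT := fun _ => by linarith,
      hMvP := fun h => absurd hP h,
      𝒲₃ := fun _ _ => 0, D𝒪 := fun _ _ _ => 0, ρ := 1, hρ := zero_lt_one,
      h𝒲m := fun _ => measurable_const, h𝒲₃m := fun _ => measurable_const,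
      h𝒲₃ := fun _ _ _ => by rw [mul_zero],
      R := fun Y => (invTau c ((tsys P.d (L * domCount P M (k + 1))).dj Y))⁻¹ + 3,
      c₀ := fun _ => 0, c₃ := fun _ => 0, c₃' := fun _ => 0, c₄ := fun _ => 0, c₁ := fun _ => 0, c₁' := fun _ => 0, c₂ := fun _ => 0,
      hR := fun Y _ => by have := inv_pos.2 (hposY Y); linarith,
      hc₃ := fun _ _ => le_rfl, hc₃' := fun _ _ => le_rfl, hc₄ := fun _ _ => le_rfl, hc₁ := fun _ _ => le_rfl, hc₁' := fun _ _ => le_rfl, hc₂ := fun _ _ => le_rfl,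
      hUτR := fun Y _ w hw => by rw [mem_ball, dist_zero_right] at hw; exact hw.le,
      h1 := fun _ _ _ _ => by rw [norm_zero, zero_mul],
      S := fun _ => ∅,
      h1loc := fun _ _ _ _ => by rw [norm_zero, zero_mul, zero_mul],
      cubeOf := fun _ _ => 0,
      hS := fun _ _ b hb => absurd hb (Finset.notMem_empty _),
      Cp := 0, κp := B12TreeDecay.kappa₀ (4 * 2 ^ P.d) (2 * P.d), hCp := le_rfl, hκp := le_rfl,
      hdecay := fun _ _ => by rw [mul_zero, zero_mul],
      h2 := fun _ _ _ _ => by rw [sub_zero, norm_zero, zero_mul],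
      h3 := fun _ _ _ => by rw [norm_zero, zero_mul],
      S₀ := ∅,
      hbox := fun _ _ b hb => absurd hb (Set.notMem_empty _),
      hloc𝒲 := fun _ _ _ _ _ => rfl,
      δ := 1 / 40, hδ := by norm_num,
      h𝒪m := fun _ _ _ => measurable_const, hD𝒪m := fun _ _ _ => measurable_const,
      hD𝒪 := fun _ _ _ _ _ => by rw [mul_zero],
      h0 := fun _ _ _ _ => by rw [norm_zero],
      h4 := fun _ _ _ _ _ _ => by rw [sub_zero, norm_zero, zero_mul],
      h5 := fun _ _ _ _ _ _ => by rw [sub_zero, sub_zero, norm_zero, zero_mul],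
      h6 := fun _ _ _ _ _ => by rw [norm_zero, zero_mul],
      hloc𝒪 := fun _ _ _ _ _ _ _ => rfl,
      hOhol := fun O _ cv _ _ Y A => differentiableOn_const _,
      ha' := by norm_num,
      hw' := by simp,
      hac := by norm_num,
      hwc := by simp,
      hw₀ := by simp,
      hMan := fun old _ b _ => by simp only [hA1, hGam]; exact analyticAt_const,
      hVan := fun old _ _ => by simp only [hA1', hGam']; exact analyticAt_const }

end YMDAG.N22.W1

end
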